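import Summits.AtomisticToContinuum.Crystallization.Theses.PhononSlackCertificates
import Summits.AtomisticToContinuum.Crystallization.Theorems.PhononSlackCertificatesWindowOptimalityCut
import Summits.AtomisticToContinuum.Crystallization.Theorems.PhononSlackCertificatesWindowOptimalityMatch
import Summits.AtomisticToContinuum.Crystallization.Theorems.PhononSlackCertificatesPeriodicGivenLayeredWindowBounds1
import Summits.AtomisticToContinuum.Crystallization.Theorems.PhononSlackCertificatesPeriodicGivenLayeredWindowBounds2
import Literature.MathematicalPhysics.StatisticalMechanics.LocalLimitOfGroundStates

/-!
# `PeriodicGivenLayered` (stmt-AtomisticToContinuum-11779), line `Sketch`: stub `stub_windowBounds`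

Stub 3 of the lead skeleton `PeriodicGivenLayered` (two-sided window bounds), proved:

* **(U)** `wb_upper`: there is `C` such that for every sequence `x` of Lennard-Jones ground states,
  every set `S` in the hull of `x` (two-way `ε`-matched on every ball by translates of `x N`,
  frequently in `N`) and every finite `W ⊆ S`,
  `Σ_{p ∈ W} e_p(S) ≤ 2 E(#W) + C Σ_{p ∈ W} (1 + dist(p, S ∖ W))⁻³`.
  Proof (cut, then limit): ground states are `δ`-separated (`LennardJonesMinimalDistance_holds`),
  hence so is `S` (`wb_sep_of_hull`).  Given `θ > 0` choose a locality radius `L` (tail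
  `#W·τ(L) ≤ θ/2`), the finite near sets `F p` (part I), a modulus `ω` with `ω Σ #F p ≤ θ/2`, a
  precision `ε` valid for `V_LJ` at the finitely many near distances, a radius `R` containing the
  `L`-neighbourhood of `W` and all the distances `dist(p, S ∖ W)`, then `N > #W` and `t` from the
  hull hypothesis.  Part II (`wb_finiteN`: strict binding `cut_lt` for the particles matched to `W`,
  cross terms bounded by the boundary functional) gives
  `Σ_{p ∈ W} 𝓔^{π p} < 2 E(#W) + C·∂W`, and part II (S1) with part I (`wb_tsum_le_near`) gives
  `e_p(S) ≤ 𝓔^{π p} + ω #F p + τ(L)`; let `θ → 0`.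
* **(L)** `wb_lower` (part I): for `δ`-separated `S`, `Σ_{p ∈ W} e_p(S) ≥ 2 E(#W) − C(δ)·∂W`.

`[folklore]`; lands `--supports` the crux (registered stub `stub_windowBounds`).
-/

noncomputable section

namespace Summit.AtomisticToContinuum.Crystallization.Theorems.LayeredHull

open scoped BigOperators Topology
open Filter Literature.MathematicalPhysics.StatisticalMechanics
open Summit.AtomisticToContinuum.Crystallization.Theorems.PhononSlackWindowOptimality
  (eventually_sub_le_lennardJones)

-- `E3 = EuclideanSpace ℝ (Fin 3)` as the (reducible) library abbreviation, so that the statement of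
-- the registered stub reads verbatim as in the lead skeleton without declaring notation here.
open Summit.AtomisticToContinuum.Crystallization.Theorems.ChargedEnergyGapNegative (E3)

/-- `E(0) = 0`: the empty configuration is the only configuration of `0` particles and has no
interaction. [folklore] -/
theorem wb_groundStateEnergy_zero : groundStateEnergy lennardJones 3 0 = 0 := by
  unfold groundStateEnergy
  haveI : Nonempty {x : Fin 0 → E3 // Function.Injective x} := ⟨⟨fun _ => 0, fun i => i.elim0⟩⟩
  have h : ∀ x : {x : Fin 0 → E3 // Function.Injective x},
      interactionEnergy lennardJones x.1 = 0 :=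
    fun x => interactionEnergy_of_subsingleton lennardJones x.1
  simp [h]

/-- **(U) The cut-and-paste upper bound in the hull.** There is `C` such that for every sequence
`x` of Lennard-Jones ground states, every `S` two-way matched at every scale by translates of
`x N` (frequently in `N`) and every finite `W ⊆ S`:
`Σ_{p ∈ W} e_p(S) ≤ 2 E(#W) + C Σ_{p ∈ W} (1 + dist(p, S ∖ W))⁻³`
(`C = (1024/(6δ³))(1 + 3/(2δ))³`, `δ` the uniform minimal distance of ground states). [folklore] -/
theorem wb_upper : ∃ C : ℝ, ∀ x : (N : ℕ) → (Fin N → E3), (∀ N, IsGroundState lennardJones (x N)) →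
      ∀ S : Set E3, (∀ R ε : ℝ, 0 < ε → ∃ᶠ N in atTop, ∃ t : E3,
        (∀ p ∈ S, ‖p‖ ≤ R → ∃ i : Fin N, dist (x N i + t) p ≤ ε) ∧
        (∀ i : Fin N, ‖x N i + t‖ ≤ R → ∃ p ∈ S, dist (x N i + t) p ≤ ε)) →
      ∀ W : Finset E3, (↑W : Set E3) ⊆ S →
        ∑ p ∈ W, (∑' q : {q : E3 // q ∈ S ∧ q ≠ p}, lennardJones (dist p (q : E3))) ≤
          2 * groundStateEnergy lennardJones 3 W.card +
            C * ∑ p ∈ W, (1 + Metric.infDist p (S \ (↑W : Set E3)))⁻¹ ^ 3 := by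
  classical
  obtain ⟨δ, hδ, hsepx⟩ := LennardJonesMinimalDistance_holds
  refine ⟨1024 / (6 * δ ^ 3) * (1 + 3 / (2 * δ)) ^ 3, fun x hx S hhull W hWS => ?_⟩
  -- the hull set is `δ`-separated
  have hS : ∀ p ∈ S, ∀ q ∈ S, p ≠ q → δ ≤ dist p q := wb_sep_of_hull δ x hx hsepx S hhull
  -- the trivial case `W = ∅`
  rcases W.eq_empty_or_nonempty with rfl | hWne
  · simp [wb_groundStateEnergy_zero]
  have hD0 : 0 ≤ ∑ p ∈ W, (1 + Metric.infDist p (S \ (↑W : Set E3)))⁻¹ ^ 3 :=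
    Finset.sum_nonneg fun p _ =>
      pow_nonneg (inv_nonneg.2 (add_nonneg zero_le_one Metric.infDist_nonneg)) 3
  refine le_of_forall_pos_lt_add fun θ hθ => ?_
  -- (1) the locality radius `L`
  have hM1 : (1 : ℝ) ≤ W.card := by exact_mod_cast hWne.card_pos
  set L : ℝ := max (max 1 (2 * δ)) (8192 * W.card / (3 * δ ^ 3 * θ)) with hLdef
  have hL1 : 1 ≤ L := le_trans (le_max_left _ _) (le_max_left _ _)
  have hδL : δ ≤ L / 2 := by
    have : 2 * δ ≤ L := le_trans (le_max_right _ _) (le_max_left _ _)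
    linarith
  have hτ : (W.card : ℝ) * (1 / 6 * (1024 / (δ ^ 3 * (L / 2) ^ 3))) ≤ θ / 2 := by
    have hδ3 : 0 < δ ^ 3 := by positivity
    have hL0 : 0 < L := by linarith
    have hLL : L ≤ L ^ 3 := by
      have h := mul_nonneg (mul_nonneg hL0.le (sub_nonneg.2 hL1)) (by linarith : (0 : ℝ) ≤ L + 1)
      nlinarith [h]
    have h1 : 8192 * W.card / (3 * δ ^ 3 * θ) ≤ L := le_max_right _ _
    rw [div_le_iff₀ (by positivity)] at h1
    have h2 : 3 * δ ^ 3 * θ * L ≤ 3 * δ ^ 3 * θ * L ^ 3 :=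
      mul_le_mul_of_nonneg_left hLL (by positivity)
    rw [show (W.card : ℝ) * (1 / 6 * (1024 / (δ ^ 3 * (L / 2) ^ 3))) =
      4096 * W.card / (3 * (δ ^ 3 * L ^ 3)) by field_simp; ring]
    rw [div_le_iff₀ (by positivity)]
    linarith
  -- (2) the near finsets `F p` and their total count `n`
  choose F hF using fun p : E3 => wb_exists_nearFinset hδ hS p L
  have hn0 : (0 : ℝ) ≤ ∑ p ∈ W, ((F p).card : ℝ) := Finset.sum_nonneg fun p _ => Nat.cast_nonneg _
  -- (3) the modulus `ω`
  have hn1 : (0 : ℝ) < 2 * (∑ p ∈ W, ((F p).card : ℝ) + 1) := by linarith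
  obtain ⟨ω, hωpos, hωn⟩ : ∃ ω : ℝ, 0 < ω ∧ ω * (∑ p ∈ W, ((F p).card : ℝ)) ≤ θ / 2 := by
    refine ⟨θ / (2 * (∑ p ∈ W, ((F p).card : ℝ) + 1)), div_pos hθ hn1, ?_⟩
    rw [div_mul_eq_mul_div, div_le_iff₀ hn1]
    nlinarith
  -- (4) the matching precision `ε`
  have hevε : ∀ᶠ ε in 𝓝[>] (0 : ℝ), (0 < ε ∧ 2 * ε < δ ∧ ε ≤ 1 / 4) ∧
      ∀ p ∈ W, ∀ q ∈ F p, ∀ r : ℝ, |r - dist p q.1| ≤ 2 * ε →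
        lennardJones (dist p q.1) - ω ≤ lennardJones r := by
    refine Filter.Eventually.and ?_ ?_
    · have h0 : ∀ᶠ ε in 𝓝[>] (0 : ℝ), 0 < ε := eventually_mem_nhdsWithin
      have h1 : ∀ᶠ ε in 𝓝[>] (0 : ℝ), ε < δ / 2 :=
        (eventually_lt_nhds (half_pos hδ)).filter_mono nhdsWithin_le_nhds
      have h3 : ∀ᶠ ε in 𝓝[>] (0 : ℝ), ε < 1 / 4 :=
        (eventually_lt_nhds (by norm_num : (0 : ℝ) < 1 / 4)).filter_mono nhdsWithin_le_nhds
      filter_upwards [h0, h1, h3] with ε a b d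
      exact ⟨a, by linarith, d.le⟩
    · rw [eventually_all_finset]
      intro p _
      rw [eventually_all_finset]
      intro q _
      exact eventually_sub_le_lennardJones (dist_ne_zero.2 fun h => q.2.2 h.symm) hωpos
  obtain ⟨ε, ⟨hε0, hεδ, hε4⟩, hωε⟩ := hevε.exists
  have hεL : 4 * ε ≤ L := by linarith
  -- (5) the radius `R`
  set B : ℝ := ∑ p ∈ W, (‖p‖ + Metric.infDist p (S \ (↑W : Set E3))) with hBdef
  have hB : ∀ p ∈ W, ‖p‖ + Metric.infDist p (S \ (↑W : Set E3)) ≤ B := fun p hp =>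
    Finset.single_le_sum (f := fun p => ‖p‖ + Metric.infDist p (S \ (↑W : Set E3)))
      (fun q _ => add_nonneg (norm_nonneg _) Metric.infDist_nonneg) hp
  set R : ℝ := B + L + 1 with hRdef
  have hR1 : ∀ p ∈ W, ‖p‖ + L ≤ R - ε := fun p hp => by
    have h1 := hB p hp
    have h0 : 0 ≤ Metric.infDist p (S \ (↑W : Set E3)) := Metric.infDist_nonneg
    rw [hRdef]
    linarith
  have hR2 : ∀ p ∈ W, ‖p‖ + Metric.infDist p (S \ (↑W : Set E3)) ≤ R - 2 * ε := fun p hp => by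
    have h1 := hB p hp
    rw [hRdef]
    linarith
  -- (6) `N > #W` and the translation `t` from the hull hypothesis
  obtain ⟨N, ⟨t, hcover, hfit⟩, hNW⟩ :=
    ((hhull R ε hε0).and_eventually (eventually_gt_atTop W.card)).exists
  -- (7) the translated ground state `y` and the matching `π`
  set y : Fin N → E3 := fun i => x N i + t with hydef
  have hyg : IsGroundState lennardJones y :=
    ⟨fun i j h => (hx N).1 (add_right_cancel h), by
      rw [hydef, interactionEnergy_add_const]; exact (hx N).2⟩
  have hsep : ∀ i j, i ≠ j → δ ≤ dist (y i) (y j) := fun i j hij => by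
    have e : dist (y i) (y j) = dist (x N i) (x N j) := dist_add_right _ _ _
    rw [e]
    exact hsepx N (x N) (hx N) i j hij
  haveI : Nonempty (Fin N) := ⟨⟨0, by omega⟩⟩
  choose! π hπ using hcover
  have hπ' : ∀ s ∈ S, ‖s‖ ≤ R → dist (y (π s)) s ≤ ε := fun s hs hsR => hπ s hs hsR
  have hfit' : ∀ i, ‖y i‖ ≤ R → ∃ s ∈ S, dist (y i) s ≤ ε := fun i hi => hfit i hi
  -- (8) the finite-`N` cut
  have hcut := wb_finiteN hδ hsep hS hεδ hε0.le hε4 hπ' hfit' hyg hWS hWne hNW hR2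
  -- (9) the per-site comparison
  have hsite : ∀ p ∈ W, ∑' q : {q : E3 // q ∈ S ∧ q ≠ p}, lennardJones (dist p (q : E3)) ≤
      siteEnergy lennardJones y (π p) + ω * (F p).card +
        1 / 6 * (1024 / (δ ^ 3 * (L / 2) ^ 3)) := by
    intro p hp
    have h1 := wb_tsum_le_near hδ hS (hWS hp) hL1 (F p) (hF p)
    have h2 := wb_near_sub_le_siteEnergy hδ hsep hS hεδ hε0.le hπ' hfit' hδL hεL (hWS hp)
      (hR1 p hp) (F p) (hF p) (hωε p hp)
    linarith
  have hsum := Finset.sum_le_sum hsite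
  rw [Finset.sum_add_distrib, Finset.sum_add_distrib, Finset.sum_const, nsmul_eq_mul,
    ← Finset.mul_sum] at hsum
  -- (10) arithmetic
  linarith

/-- **Stub 3 (window bounds)** of the line `Sketch` of `PeriodicGivenLayered`: (U) the
cut-and-paste upper bound in the hull (`wb_upper`) and (L) the free lower bound for separated sets
(`wb_lower`, part I). [folklore] -/
theorem stub_windowBounds :
    (∃ C : ℝ, ∀ x : (N : ℕ) → (Fin N → E3), (∀ N, IsGroundState lennardJones (x N)) →
      ∀ S : Set E3, (∀ R ε : ℝ, 0 < ε → ∃ᶠ N in atTop, ∃ t : E3,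
        (∀ p ∈ S, ‖p‖ ≤ R → ∃ i : Fin N, dist (x N i + t) p ≤ ε) ∧
        (∀ i : Fin N, ‖x N i + t‖ ≤ R → ∃ p ∈ S, dist (x N i + t) p ≤ ε)) →
      ∀ W : Finset E3, (↑W : Set E3) ⊆ S →
        ∑ p ∈ W, (∑' q : {q : E3 // q ∈ S ∧ q ≠ p}, lennardJones (dist p (q : E3))) ≤
          2 * groundStateEnergy lennardJones 3 W.card +
            C * ∑ p ∈ W, (1 + Metric.infDist p (S \ (↑W : Set E3)))⁻¹ ^ 3) ∧
    (∀ δ : ℝ, 0 < δ → ∃ C : ℝ, ∀ S : Set E3, (∀ p ∈ S, ∀ q ∈ S, p ≠ q → δ ≤ dist p q) →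
      ∀ W : Finset E3, (↑W : Set E3) ⊆ S →
        2 * groundStateEnergy lennardJones 3 W.card -
            C * ∑ p ∈ W, (1 + Metric.infDist p (S \ (↑W : Set E3)))⁻¹ ^ 3 ≤
          ∑ p ∈ W, (∑' q : {q : E3 // q ∈ S ∧ q ≠ p}, lennardJones (dist p (q : E3)))) :=
  ⟨wb_upper, wb_lower⟩

end Summit.AtomisticToContinuum.Crystallization.Theorems.LayeredHull

end
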